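import Summits.KontsevichZagierPeriods.KontsevichZagierPeriods.Theorems.TerasomaMultiplicationBetaCancellationStubFibreSubstitutionTwoCatalystsAE
import Summits.KontsevichZagierPeriods.KontsevichZagierPeriods.Theorems.TerasomaMultiplicationBetaCancellationStubEquivalentOfAEJacobian
import Summits.KontsevichZagierPeriods.KontsevichZagierPeriods.Theorems.TerasomaMultiplicationBetaCancellationStubAbsDetFDerivSemialgebraic
import Literature.NumberTheory.Transcendental.KZLogCalculusProofs
import Literature.NumberTheory.Transcendental.KZRelationsLE
import Literature.ModelTheory.ExponentialFields.SemialgebraicInterior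

/-!
# `BetaCancellation` (stmt-KontsevichZagierPeriods-13633), line `dirichlet-companion-to-pi` — stub `stub_fibreSubstitutionTwoCatalysts` (assembly, seat c14 cycle 4): CATALYST EXCHANGE

Companion of `TerasomaMultiplicationBetaCancellationFibreSubstitution.lean` (one catalyst). Here the
source product is pinned over a catalyst `p₁` and the target over a catalyst `p₂` of the same dimension,
both of non-zero value, and `c · p₂.value = p₁.value` with `c` real ALGEBRAIC (e.g. disc ↦ half-disc or
disc of radius `1/√2`, `c = 2`; a symmetric half of the Beta interval at `a = b`, `c = 2`). One fibre-form
substitution `Φ : p₁ ⊗ r → p₂ ⊗ r'` then yields `r.constMul c ∼ r'` (`stub_fibreSubstitutionTwoCatalysts`):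
the a.e. identity `c · f = (f' ∘ ψ)|det ψ'|` (`stub_fibreSubstitutionTwoCatalystsAE`) is upgraded to a
move exactly as in the one-catalyst file (interior of `r.domain`, semialgebraic Jacobian, null
semialgebraic defect set, co-null image restriction), applied to the scaled representation `r.constMul c`
(`KZ.IntegralRep.constMul`, same domain, integrand `c · f`). Piece by piece this covers the PIECEWISE
fibre-form certificates whose catalyst pieces have algebraic mass fractions (crux notes c14 K5 (iv)); a
transcendental fraction (a disc segment, an incomplete Beta value) is the finishing obstruction of seats
c7/c8 seen inside one substitution. No definitions; sorry-free; axioms ⊆ {propext, Classical.choice,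
Quot.sound}.

References: M. Kontsevich, D. Zagier, *Periods* (2001), §1.2 rule (2).
-/

noncomputable section

-- `Summit.KontsevichZagierPeriods.KontsevichZagierPeriods.…` is the tree's mandated layout (single-conjunct summit).
set_option linter.dupNamespace false

namespace Summit.KontsevichZagierPeriods.KontsevichZagierPeriods.BetaCancellationLine

open MeasureTheory Set
open Literature.ModelTheory.ExponentialFields (IsSemialgebraic isSemialgebraic_interior
  isSemialgebraic_diff_interior)
open Literature.NumberTheory.Transcendental
open Literature.NumberTheory.Transcendental.KZ

/-- STUB (assembly, held by the lead, seat c14 cycle 4). **Catalyst exchange.** If `q = p₁ ⊗ r` and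
`q' = p₂ ⊗ r'` (catalysts of the same dimension and non-zero values) are related by ONE change of variables of
fibre form over a `ℚ`-semialgebraic substitution `ψ` injective on `r.domain` with a derivative within it, and
`c` is a real ALGEBRAIC number with `c · p₂.value = p₁.value`, then `r.constMul c ∼ r'`: the scaled base
descends. (`p₂ = p₁`, `c = 1` is `stub_fibreSubstitution`.) [folklore] -/
theorem stub_fibreSubstitutionTwoCatalysts {d n : ℕ} (p₁ p₂ : IntegralRep d) (hp₁ : p₁.value ≠ 0)
    (hp₂ : p₂.value ≠ 0) (c : ℝ) (hc : IsAlgebraic ℚ c) (hcv : c * p₂.value = p₁.value)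
    (r r' : IntegralRep n) (q q' : IntegralRep (d + n))
    (hq : q.domain = {z | (fun i => z (Fin.castAdd n i)) ∈ p₁.domain ∧
      (fun j => z (Fin.natAdd d j)) ∈ r.domain})
    (hqi : Set.EqOn q.integrand (fun z => p₁.integrand (fun i => z (Fin.castAdd n i)) *
      r.integrand (fun j => z (Fin.natAdd d j))) q.domain)
    (hq' : q'.domain = {z | (fun i => z (Fin.castAdd n i)) ∈ p₂.domain ∧
      (fun j => z (Fin.natAdd d j)) ∈ r'.domain})
    (hq'i : Set.EqOn q'.integrand (fun z => p₂.integrand (fun i => z (Fin.castAdd n i)) *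
      r'.integrand (fun j => z (Fin.natAdd d j))) q'.domain)
    (Φ : (Fin (d + n) → ℝ) → (Fin (d + n) → ℝ))
    (Φ' : (Fin (d + n) → ℝ) → (Fin (d + n) → ℝ) →L[ℝ] (Fin (d + n) → ℝ))
    (hΦ' : ∀ z ∈ q.domain, HasFDerivWithinAt Φ (Φ' z) q.domain z) (hΦinj : Set.InjOn Φ q.domain)
    (himg : q'.domain = Φ '' q.domain)
    (hjac : ∀ z ∈ q.domain, q.integrand z = q'.integrand (Φ z) * |(Φ' z).det|)
    (ψ : (Fin n → ℝ) → (Fin n → ℝ)) (ψ' : (Fin n → ℝ) → (Fin n → ℝ) →L[ℝ] (Fin n → ℝ))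
    (hψsa : IsSemialgebraicMapOn ℚ r.domain ψ)
    (hfib : ∀ z ∈ q.domain, (fun j => Φ z (Fin.natAdd d j)) = ψ (fun j => z (Fin.natAdd d j)))
    (hψ' : ∀ w ∈ r.domain, HasFDerivWithinAt ψ (ψ' w) r.domain w) (hψinj : Set.InjOn ψ r.domain) :
    Equivalent (r.constMul c hc) r' := by
  -- (0) the a.e. rule-(2) identity on `σ := r.domain` (measure core)
  have hae := stub_fibreSubstitutionTwoCatalystsAE p₁ p₂ hp₁ hp₂ c hcv r r' q q' hq hqi hq' hq'i
    Φ Φ' hΦ' hΦinj himg hjac ψ ψ' hfib hψ' hψinj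
  have hσm : MeasurableSet r.domain := IntegralRep.measurableSet_domain_holds r
  -- (1) `σ' = ψ '' σ`
  have hKne : ∀ p : IntegralRep d, p.value ≠ 0 → p.domain.Nonempty := by
    intro p hp
    by_contra h
    apply hp
    rw [not_nonempty_iff_eq_empty] at h
    simp [IntegralRep.value, h]
  obtain ⟨x₀, hx₀⟩ := hKne p₁ hp₁
  obtain ⟨x₂, hx₂⟩ := hKne p₂ hp₂
  have hmemq : ∀ z, z ∈ q.domain ↔ (fun i => z (Fin.castAdd n i)) ∈ p₁.domain ∧
      (fun j => z (Fin.natAdd d j)) ∈ r.domain := fun z => by rw [hq]; rfl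
  have hmemq' : ∀ z, z ∈ q'.domain ↔ (fun i => z (Fin.castAdd n i)) ∈ p₂.domain ∧
      (fun j => z (Fin.natAdd d j)) ∈ r'.domain := fun z => by rw [hq']; rfl
  have hσ' : r'.domain = ψ '' r.domain := by
    apply Subset.antisymm
    · intro w' hw'
      have hz' : Fin.append x₂ w' ∈ q'.domain := by
        rw [hmemq']
        simpa using And.intro hx₂ hw'
      rw [himg] at hz'
      obtain ⟨z, hz, hzw⟩ := hz'
      refine ⟨fun j => z (Fin.natAdd d j), ((hmemq z).1 hz).2, ?_⟩
      rw [← hfib z hz, hzw]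
      funext j
      simp
    · rintro _ ⟨w, hw, rfl⟩
      have hz : Fin.append x₀ w ∈ q.domain := by
        rw [hmemq]
        simpa using And.intro hx₀ hw
      have hz' : Φ (Fin.append x₀ w) ∈ q'.domain := himg ▸ mem_image_of_mem Φ hz
      rw [hmemq', hfib _ hz] at hz'
      simpa using hz'.2
  -- the scaled base `c • r` (same domain, integrand `c * f`)
  set rc : IntegralRep n := r.constMul c hc with hrc
  -- (2) pass to the interior `U` of `σ`
  set U : Set (Fin n → ℝ) := interior r.domain with hU
  have hUσ : U ⊆ r.domain := interior_subset
  have hUs : IsSemialgebraic ℚ U := isSemialgebraic_interior r.isSemialgebraic_domain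
  have hUo : IsOpen U := isOpen_interior
  have hU0 : volume (r.domain \ U) = 0 :=
    volume_eq_zero_of_interior_eq_empty (isSemialgebraic_diff_interior r.isSemialgebraic_domain).1
      (isSemialgebraic_diff_interior r.isSemialgebraic_domain).2
  set r₀ : IntegralRep n := rc.restrict U hUs hUσ with hr₀
  have h1 : of rc - of r₀ ∈ relations := IntegralRep.of_sub_of_restrict_mem_relations rc hUs hUσ hU0
  -- (3) the image side
  have hψU : IsSemialgebraic ℚ (ψ '' U) :=
    IsSemialgebraicMapOn.isSemialgebraic_image_holds hψsa hUσ hUs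
  have hψUσ' : ψ '' U ⊆ r'.domain := hσ' ▸ image_mono hUσ
  set r'₀ : IntegralRep n := r'.restrict (ψ '' U) hψU hψUσ' with hr'₀
  have h2 : of r' - of r'₀ ∈ relations := by
    refine IntegralRep.of_sub_of_restrict_mem_relations r' hψU hψUσ' ?_
    have hsub : r'.domain \ ψ '' U ⊆ ψ '' (r.domain \ U) := by
      intro w' hw'
      rw [hσ'] at hw'
      obtain ⟨⟨w, hw, rfl⟩, hnot⟩ := hw'
      exact ⟨w, ⟨hw, fun hwU => hnot (mem_image_of_mem ψ hwU)⟩, rfl⟩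
    exact measure_mono_null hsub (aeJacobian_volume_image_null ψ ψ' hψ' (fun _ h => h.1)
      (hσm.diff hUo.measurableSet) hU0)
  -- (4) on `U`, `ψ' = fderiv ℝ ψ`, so `|det ψ'|` is semialgebraic there
  have hfd : ∀ w ∈ U, HasFDerivAt ψ (ψ' w) w := fun w hw =>
    (hψ' w (hUσ hw)).hasFDerivAt (mem_interior_iff_mem_nhds.1 hw)
  have hdet : IsSemialgebraicFunOn ℚ U fun w => |(ψ' w).det| :=
    (stub_absDetFDeriv_semialgebraic hUo hUs ψ (hψsa.mono hUσ hUs)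
      fun w hw => (hfd w hw).differentiableAt).congr fun w hw => by
        show |(fderiv ℝ ψ w).det| = _
        rw [(hfd w hw).fderiv]
  -- (5) the bookkeeping stub on the restricted representations
  have h3 : Equivalent r₀ r'₀ := by
    refine stub_equivalent_of_aeJacobian r₀ r'₀ ψ ψ' (hψsa.mono hUσ hUs)
      (fun w hw => (hψ' w (hUσ hw)).mono hUσ) (hψinj.mono hUσ) rfl hdet ?_
    have := (ae_restrict_of_ae_restrict_of_subset hUσ hae)
    simpa [hr₀, hr'₀, hrc] using this
  -- (6) assemble
  have h123 : of rc - of r' = (of rc - of r₀) + (of r₀ - of r'₀) - (of r' - of r'₀) := by abel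
  change of rc - of r' ∈ relations
  rw [h123]
  exact relations.sub_mem (relations.add_mem h1 h3) h2



end Summit.KontsevichZagierPeriods.KontsevichZagierPeriods.BetaCancellationLine

end
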